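import Summits.BirchSwinnertonDyer.Rank1Residual.WAll.TargetAdditiveAtThreePotSSImage
import Summits.BirchSwinnertonDyer.Rank1Residual.Additive.WildThreeKrausCells
import HarnessLib
import Summits.BirchSwinnertonDyer.BirchSwinnertonDyer.Theses.CyclotomicUntwist
import Summits.BirchSwinnertonDyer.BirchSwinnertonDyer.Theorems.CyclotomicUntwistPSRankOneLowerHalfAtThreeGNineCriterion

/-! Line `birth` (v3, lead bsd-line-cycu-p1 g0) for the deciding crux `PSRankOneLowerHalfAtThree` (route
CyclotomicUntwist). Stub 1 = the route's FIRST LEMMA `GNineCriterion` (principal-series rows ⊆ the tree's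
(G₉) rows) — LANDED (p583210), imported; stub 2 = the BC5 first rung (tower-surjective, 3 ∤ Tamagawa
rows); stub 3 = the rest; composition real (sorries = 2 = the open stubs, both crux-sized: the
finite-slope road — 3-adic Gross–Zagier at slope 1/2, Wan-direction IMC₃ for the untwist, Perrin-Riou
leading-term reading — whose typed split awaits the planner now that D1 `IsPSCyclotomicLFunctionOf`
and D2 `PSLineHeightData` are in the tree). -/

set_option linter.dupNamespace false
noncomputable section
open scoped Classical
open WeierstrassCurve Literature.NumberTheory.EllipticCurves
  Literature.NumberTheory.EllipticCurves.Rank1Residual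

namespace Summit.BirchSwinnertonDyer.BirchSwinnertonDyer.Cruxes.PSRankOneLowerHalfAtThree.Birth

/-! stub 1 (FIRST LEMMA `GNineCriterion`) is CLOSED: the landed theorem
`Summit.BirchSwinnertonDyer.BirchSwinnertonDyer.Cruxes.PSRankOneLowerHalfAtThree.Birth.stub_gNineCriterion`
(`Theorems/CyclotomicUntwistPSRankOneLowerHalfAtThreeGNineCriterion.lean`, cycu-p2 g0, p583210, registered
signature verbatim, 0 sorry; explicit good-reduction models over `ℚ(ζ₉)`; companion explicit-recipe files
`CyclotomicUntwistGNine{Toolkit,Leaves,LeafIV}.lean`, cycu-p1 g0) is imported above and used by name in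
the composition below. -/

/-- stub 2 = the BC5 FIRST RUNG (plan-only, size L–XL): the lower half in analytic rank one on the
onto (G₉) rows whose 3-ADIC TOWER image is surjective and whose Tamagawa product is prime to 3 —
the rows on which the Perrin-Riou–Colmez leading-term reading carries no local correction, so the
rung isolates exactly the non-transferring step (3-adic Gross–Zagier for (E, η) at slope 1/2).
Technique: Kato IMC₃ for (f_E, 3) (FouquetWan2021 Thm 1.7 locus / Kato2004 Thm 12.5 + Wan-type
converse for the level-9M form g), 3-adic Gross–Zagier for g by Kobayashi's method (Kobayashi2013
§§3–5 with the slope-1/2 stabilisation), PerrinRiou1993AIF / Colmez1998Annals leading term. -/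
theorem stub_rung_lowerHalfOnGNine_towerUnit :
    ∀ (W : WeierstrassCurve ℚ) [W.IsElliptic] [W.IsGloballyMinimal],
      ¬ W.HasCM → Summit.BirchSwinnertonDyer.Rank1Residual.Additive.ClassO6 W 3 → Surj W 3 →
      Summit.BirchSwinnertonDyer.Rank1Residual.Additive.TypeGNine W →
      ((∀ n : ℕ, W.HasSurjectiveModNGaloisRep (3 ^ n : ℕ)) ∧ ¬ 3 ∣ W.tamagawaProduct) →
      W.analyticRank = 1 → Typed.MissingLowerBoundAt W 3 := by
  sorry

/-- stub 3 (size XL): the lower half on the remaining onto (G₉) rows (3-adic tower image not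
surjective, or 3 ∣ Tamagawa product: Kodaira IV/IV* with c₃ = 3, or c_ℓ = 3 away from 3) — same
road with the local index `exp* H¹(ℚ₃,T) = c₃·3^{-t}ℤ₃ dR` and the Tamagawa terms kept in the
leading-term reading. -/
theorem stub_lowerHalfOnGNine_rest :
    ∀ (W : WeierstrassCurve ℚ) [W.IsElliptic] [W.IsGloballyMinimal],
      ¬ W.HasCM → Summit.BirchSwinnertonDyer.Rank1Residual.Additive.ClassO6 W 3 → Surj W 3 →
      Summit.BirchSwinnertonDyer.Rank1Residual.Additive.TypeGNine W →
      ¬ ((∀ n : ℕ, W.HasSurjectiveModNGaloisRep (3 ^ n : ℕ)) ∧ ¬ 3 ∣ W.tamagawaProduct) →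
      W.analyticRank = 1 → Typed.MissingLowerBoundAt W 3 := by
  sorry

/-- COMPOSITION (line `birth`, lead bsd-line-cycu-p1 g0): the route crux BY NAME from the three registered stubs —
the first lemma `stub_gNineCriterion` turns the principal-series predicate (`v₃(Δ_min)` even, unit part `≡ 1 (mod 3)`)
into the structural hypothesis (G₉) (`TypeGNine`), then the case split on «3-adic tower onto ∧ 3 ∤ Tamagawa product»
dispatches to the BC5 first rung `stub_rung_lowerHalfOnGNine_towerUnit` or to `stub_lowerHalfOnGNine_rest`. Sorry-free. -/
theorem PSRankOneLowerHalfAtThree_of :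
    Summit.BirchSwinnertonDyer.BirchSwinnertonDyer.Theses.CyclotomicUntwist.PSRankOneLowerHalfAtThree := by
  intro W _ _ hCM hO6 hsurj hev hsq hr
  have hG := stub_gNineCriterion W hO6 hev hsq
  by_cases hu : ((∀ n : ℕ, W.HasSurjectiveModNGaloisRep (3 ^ n : ℕ)) ∧ ¬ 3 ∣ W.tamagawaProduct)
  · exact stub_rung_lowerHalfOnGNine_towerUnit W hCM hO6 hsurj hG hu hr
  · exact stub_lowerHalfOnGNine_rest W hCM hO6 hsurj hG hu hr

end Summit.BirchSwinnertonDyer.BirchSwinnertonDyer.Cruxes.PSRankOneLowerHalfAtThree.Birth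
end
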